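import Summits.CriticalPhenomena.PercolationContinuityZ3.Theorems.PercNearOneGluingNoHeavyLowerTailWorstPairExchangeCex
import HarnessLib

/-!
# `NoHeavyLowerTail` (stmt-CriticalPhenomena-4575) — hull-port line: the localized exchange (LE) is FALSE, even for a relay marker
# (certified 7-vertex, 7-pair witness)

Support file (prover `prim-hp-7`, hull-port prover #7; `--supports stmt-CriticalPhenomena-4575`).  Computational (`native_decide` on 128-term
exact rational sums; evaluation pattern of `PercNearOneGluingNoHeavyLowerTailGuardedTripodCex.lean`, extended by relay-count events).  No
definitions, no named facts, no sorries.

**Background.**  In the hull-port programme (crux memo run/shared/lean/prim/prim-hp-1/HULLPORT-COUPLING.md §15–§20) the localized selection lemma LSL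
was reduced to the LOCALIZED EXCHANGE
  (LE)  `μ(D' ∩ G₊ ∩ Sel₂) · μ(D' ∩ G₋) ≤ μ(D' ∩ G₊) · μ(D' ∩ Sel₂ ∩ G₋)`,
`D' = {z ↮ x₁} ∩ {z ↮ x₂} ∩ {x₁ ↮ x₂}`, `G₊ = R_{x₂} ∖ R_{x₁}` (`x₂` light, `x₁` heavy), `G₋ = R_{x₁} ∖ R_{x₂}`, `Sel₂ = {b ↔ x₂}`,
`R_v = {|π(v)| ≤ j}` — "the marker `b` is more likely to lie in `C(x₂)` when `C(x₂)` is the heavy cluster" ("the single missing exchange",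
0 / 4 275 there).  Without the guard `z` it is a corollary of [VandenbergHaggstromKahn2005, Thm. 1.5].  The tree already has the WEAKER inequality that
suffices for LSL (`HullPort.lsl_of_sp`, the "mirror worlds" inequality (SP)); this file closes the door on (LE) itself.

**This file: (LE) is false, for a RELAY marker.**  Witness (seat memo run/shared/lean/prim/prim-hp-7/HP7-GX-FAMILY.md §2, found by a ratio-objective
climber seeded with glued hubs and simplified to seven pairs): `Fin 7`, `x₂ = 0`, `x₁ = 6`, `z = 2`, `b = 5`, relays `A = {1,3,4,5,6}`, level `j = 1`;
weights `w(0,1) = 9/10`, `w(1,3) = 1`, `w(0,5) = 1/2`, `w(4,5) = 5/6`, `w(4,6) = 1/2`, `w(2,4) = 1/2`, `w(2,5) = 9/10`, all other pairs `0`.  Exactly: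
`μ(D'∩G₊∩Sel₂) = 1/4800`, `μ(D'∩G₋) = 287/1200`, `μ(D'∩G₊) = 1/300`, `μ(D'∩Sel₂∩G₋) = 17/1200`, so
`P(b ∈ C(x₂) | D', G₊) = 1/16 > 17/287 = P(b ∈ C(x₂) | D', G₋)` (margin `1/384000`).  Mechanism: the marker `b` hangs on the guard `z` (weight `9/10`),
so `b ∈ U` costs the same factor in both worlds, while `x₂` is heavy in `G₋` mostly through the cheap pair `{1,3}` without `b`.

* `LocalizedExchangeCex.cnt_reachTable` — relay counts read off reach tables;
* `LocalizedExchangeCex.real_Dp_inter` — evaluation of `μ(D' ∩ E)` on `Fin 7` for events given by a `Bool` test on reach tables;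
* `LocalizedExchangeCex.violation_of_check` — one decidable rational fact ⇒ the violating instance;
* `localizedExchange_cex` — the instance;  `localizedExchange_false` — `¬`(LE) over all finite weighted graphs, relay sets, levels and relay markers.
-/

namespace Summit.CriticalPhenomena.PercolationContinuityZ3.Theorems

open MeasureTheory
open Literature.Probability.LatticeModels Literature.Probability.Percolation
open Summit.CriticalPhenomena.PercolationContinuityZ3.Theorems.AdditiveGluing.Negative.Cert
open scoped Classical

set_option maxHeartbeats 400000

namespace LocalizedExchangeCex

open WorstPairExchangeCex (real_eq_wcount)

/-- The relay count read off the reach table of a configuration is the relay count of the cluster. [this file] -/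
theorem cnt_reachTable (ω : List (Fin 7 × Fin 7)) (x : Fin 7) :
    ((({1, 3, 4, 5, 6} : Finset (Fin 7))).filter fun q : Fin 7 => ((reachTable 7 ω).getD x 0).testBit q.val = true).card =
      ((({1, 3, 4, 5, 6} : Finset (Fin 7))).filter fun q => (↑(Eset ω) : Set (Sym2 (Fin 7))) ∈ openConn x q).card := by
  congr 1
  exact Finset.filter_congr fun q _ => testBit_reachTable_iff_mem_openConn ω x q

/-- **Evaluation of `μ(D' ∩ E)` on `Fin 7`** for an event `E` whose indicator is a `Bool` test `f` on the reach table. [this file] -/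
theorem real_Dp_inter {l : List (Fin 7 × Fin 7 × ℚ)} (hnd : (wPairs l).Nodup)
    (hq : ∀ e ∈ l, 0 ≤ e.2.2 ∧ e.2.2 ≤ 1) (f : List ℕ → Bool) (E : Set (BondConfig (Fin 7)))
    (hfE : ∀ ω : List (Fin 7 × Fin 7), f (reachTable 7 ω) = true ↔ (↑(Eset ω) : Set (Sym2 (Fin 7))) ∈ E) :
    (prodBernoulli (wOfList l)).real
        ({ω : BondConfig (Fin 7) | ¬ (openGraph ω).Reachable 2 6 ∧ ¬ (openGraph ω).Reachable 2 0 ∧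
          ¬ (openGraph ω).Reachable 6 0} ∩ E) =
      ((((wtabs 7 l).map fun t => if ((!((t.1).getD 2 0).testBit 6 && !((t.1).getD 2 0).testBit 0 && !((t.1).getD 6 0).testBit 0) && f t.1) then t.2 else 0).sum : ℚ) : ℝ) := by
  refine real_eq_wcount hnd hq (fun tb => (!((tb).getD 2 0).testBit 6 && !((tb).getD 2 0).testBit 0 && !((tb).getD 6 0).testBit 0) && f tb) _ fun ω => ?_
  have h26 := testBit_reachTable_iff_mem_openConn ω (2 : Fin 7) (6 : Fin 7)
  have h20 := testBit_reachTable_iff_mem_openConn ω (2 : Fin 7) (0 : Fin 7)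
  have h60 := testBit_reachTable_iff_mem_openConn ω (6 : Fin 7) (0 : Fin 7)
  have hf := hfE ω
  simp only [Bool.and_eq_true, Bool.not_eq_true', Set.mem_inter_iff, Set.mem_setOf_eq]
  constructor
  · rintro ⟨⟨⟨h1, h2⟩, h3⟩, h4⟩
    refine ⟨⟨fun h => ?_, fun h => ?_, fun h => ?_⟩, hf.1 h4⟩
    · have h' : ((reachTable 7 ω).getD 2 0).testBit 6 = true := h26.2 h
      rw [h'] at h1; exact Bool.noConfusion h1
    · have h' : ((reachTable 7 ω).getD 2 0).testBit 0 = true := h20.2 h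
      rw [h'] at h2; exact Bool.noConfusion h2
    · have h' : ((reachTable 7 ω).getD 6 0).testBit 0 = true := h60.2 h
      rw [h'] at h3; exact Bool.noConfusion h3
  · rintro ⟨⟨h1, h2, h3⟩, h4⟩
    refine ⟨⟨⟨?_, ?_⟩, ?_⟩, hf.2 h4⟩
    · cases h : ((reachTable 7 ω).getD 2 0).testBit 6
      · rfl
      · exact absurd (h26.1 h) h1
    · cases h : ((reachTable 7 ω).getD 2 0).testBit 0
      · rfl
      · exact absurd (h20.1 h) h2
    · cases h : ((reachTable 7 ω).getD 6 0).testBit 0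
      · rfl
      · exact absurd (h60.1 h) h3

/-- `μ(D' ∩ G₊ ∩ Sel₂)` (`x₂ = 0` light, `x₁ = 6` heavy, `b = 5 ↔ 0`) as an exact weighted count. [this file] -/
theorem real_GpSel {l : List (Fin 7 × Fin 7 × ℚ)} (hnd : (wPairs l).Nodup) (hq : ∀ e ∈ l, 0 ≤ e.2.2 ∧ e.2.2 ≤ 1) :
    (prodBernoulli (wOfList l)).real
        ({ω : BondConfig (Fin 7) | ¬ (openGraph ω).Reachable 2 6 ∧ ¬ (openGraph ω).Reachable 2 0 ∧
          ¬ (openGraph ω).Reachable 6 0} ∩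
        {ω : BondConfig (Fin 7) | ((({1, 3, 4, 5, 6} : Finset (Fin 7)).filter fun q => ω ∈ openConn 0 q).card ≤ 1 ∧
          1 < (({1, 3, 4, 5, 6} : Finset (Fin 7)).filter fun q => ω ∈ openConn 6 q).card) ∧ (openGraph ω).Reachable 0 5}) =
      ((((wtabs 7 l).map fun t => if ((!((t.1).getD 2 0).testBit 6 && !((t.1).getD 2 0).testBit 0 && !((t.1).getD 6 0).testBit 0) && (Nat.ble (((({1, 3, 4, 5, 6} : Finset (Fin 7))).filter fun q : Fin 7 => ((t.1).getD 0 0).testBit q.val = true).card) 1 && Nat.blt 1 (((({1, 3, 4, 5, 6} : Finset (Fin 7))).filter fun q : Fin 7 => ((t.1).getD 6 0).testBit q.val = true).card) &&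
          (t.1.getD 0 0).testBit 5)) then t.2 else 0).sum : ℚ) : ℝ) :=
  real_Dp_inter hnd hq (fun tb => Nat.ble (((({1, 3, 4, 5, 6} : Finset (Fin 7))).filter fun q : Fin 7 => ((tb).getD 0 0).testBit q.val = true).card) 1 && Nat.blt 1 (((({1, 3, 4, 5, 6} : Finset (Fin 7))).filter fun q : Fin 7 => ((tb).getD 6 0).testBit q.val = true).card) && (tb.getD 0 0).testBit 5)
    {ω : BondConfig (Fin 7) | ((({1, 3, 4, 5, 6} : Finset (Fin 7)).filter fun q => ω ∈ openConn 0 q).card ≤ 1 ∧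
      1 < (({1, 3, 4, 5, 6} : Finset (Fin 7)).filter fun q => ω ∈ openConn 6 q).card) ∧ (openGraph ω).Reachable 0 5} fun ω => by
    have h05 : ((reachTable 7 ω).getD 0 0).testBit 5 = true ↔ (↑(Eset ω) : Set (Sym2 (Fin 7))) ∈ openConn (0 : Fin 7) (5 : Fin 7) :=
      testBit_reachTable_iff_mem_openConn ω (0 : Fin 7) (5 : Fin 7)
    have hc0 : ((({1, 3, 4, 5, 6} : Finset (Fin 7))).filter fun q : Fin 7 => (((reachTable 7 ω)).getD 0 0).testBit q.val = true).card =
        ((({1, 3, 4, 5, 6} : Finset (Fin 7))).filter fun q => (↑(Eset ω) : Set (Sym2 (Fin 7))) ∈ openConn 0 q).card := cnt_reachTable ω 0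
    have hc6 : ((({1, 3, 4, 5, 6} : Finset (Fin 7))).filter fun q : Fin 7 => (((reachTable 7 ω)).getD 6 0).testBit q.val = true).card =
        ((({1, 3, 4, 5, 6} : Finset (Fin 7))).filter fun q => (↑(Eset ω) : Set (Sym2 (Fin 7))) ∈ openConn 6 q).card := cnt_reachTable ω 6
    rw [Bool.and_eq_true, Bool.and_eq_true, Nat.ble_eq, Nat.blt_eq, hc0, hc6, Set.mem_setOf_eq]
    exact ⟨fun ⟨⟨h1, h2⟩, h3⟩ => ⟨⟨h1, h2⟩, h05.1 h3⟩, fun ⟨⟨h1, h2⟩, h3⟩ => ⟨⟨h1, h2⟩, h05.2 h3⟩⟩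

/-- `μ(D' ∩ G₋)` (`x₁ = 6` light, `x₂ = 0` heavy) as an exact weighted count. [this file] -/
theorem real_Gm {l : List (Fin 7 × Fin 7 × ℚ)} (hnd : (wPairs l).Nodup) (hq : ∀ e ∈ l, 0 ≤ e.2.2 ∧ e.2.2 ≤ 1) :
    (prodBernoulli (wOfList l)).real
        ({ω : BondConfig (Fin 7) | ¬ (openGraph ω).Reachable 2 6 ∧ ¬ (openGraph ω).Reachable 2 0 ∧
          ¬ (openGraph ω).Reachable 6 0} ∩
        {ω : BondConfig (Fin 7) | (({1, 3, 4, 5, 6} : Finset (Fin 7)).filter fun q => ω ∈ openConn 6 q).card ≤ 1 ∧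
          1 < (({1, 3, 4, 5, 6} : Finset (Fin 7)).filter fun q => ω ∈ openConn 0 q).card}) =
      ((((wtabs 7 l).map fun t => if ((!((t.1).getD 2 0).testBit 6 && !((t.1).getD 2 0).testBit 0 && !((t.1).getD 6 0).testBit 0) && (Nat.ble (((({1, 3, 4, 5, 6} : Finset (Fin 7))).filter fun q : Fin 7 => ((t.1).getD 6 0).testBit q.val = true).card) 1 && Nat.blt 1 (((({1, 3, 4, 5, 6} : Finset (Fin 7))).filter fun q : Fin 7 => ((t.1).getD 0 0).testBit q.val = true).card))) then t.2 else 0).sum : ℚ) : ℝ) :=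
  real_Dp_inter hnd hq (fun tb => Nat.ble (((({1, 3, 4, 5, 6} : Finset (Fin 7))).filter fun q : Fin 7 => ((tb).getD 6 0).testBit q.val = true).card) 1 && Nat.blt 1 (((({1, 3, 4, 5, 6} : Finset (Fin 7))).filter fun q : Fin 7 => ((tb).getD 0 0).testBit q.val = true).card))
    {ω : BondConfig (Fin 7) | (({1, 3, 4, 5, 6} : Finset (Fin 7)).filter fun q => ω ∈ openConn 6 q).card ≤ 1 ∧
      1 < (({1, 3, 4, 5, 6} : Finset (Fin 7)).filter fun q => ω ∈ openConn 0 q).card} fun ω => by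
    have hc0 : ((({1, 3, 4, 5, 6} : Finset (Fin 7))).filter fun q : Fin 7 => (((reachTable 7 ω)).getD 0 0).testBit q.val = true).card =
        ((({1, 3, 4, 5, 6} : Finset (Fin 7))).filter fun q => (↑(Eset ω) : Set (Sym2 (Fin 7))) ∈ openConn 0 q).card := cnt_reachTable ω 0
    have hc6 : ((({1, 3, 4, 5, 6} : Finset (Fin 7))).filter fun q : Fin 7 => (((reachTable 7 ω)).getD 6 0).testBit q.val = true).card =
        ((({1, 3, 4, 5, 6} : Finset (Fin 7))).filter fun q => (↑(Eset ω) : Set (Sym2 (Fin 7))) ∈ openConn 6 q).card := cnt_reachTable ω 6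
    rw [Bool.and_eq_true, Nat.ble_eq, Nat.blt_eq, hc0, hc6, Set.mem_setOf_eq]

/-- `μ(D' ∩ G₊)` as an exact weighted count. [this file] -/
theorem real_Gp {l : List (Fin 7 × Fin 7 × ℚ)} (hnd : (wPairs l).Nodup) (hq : ∀ e ∈ l, 0 ≤ e.2.2 ∧ e.2.2 ≤ 1) :
    (prodBernoulli (wOfList l)).real
        ({ω : BondConfig (Fin 7) | ¬ (openGraph ω).Reachable 2 6 ∧ ¬ (openGraph ω).Reachable 2 0 ∧
          ¬ (openGraph ω).Reachable 6 0} ∩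
        {ω : BondConfig (Fin 7) | (({1, 3, 4, 5, 6} : Finset (Fin 7)).filter fun q => ω ∈ openConn 0 q).card ≤ 1 ∧
          1 < (({1, 3, 4, 5, 6} : Finset (Fin 7)).filter fun q => ω ∈ openConn 6 q).card}) =
      ((((wtabs 7 l).map fun t => if ((!((t.1).getD 2 0).testBit 6 && !((t.1).getD 2 0).testBit 0 && !((t.1).getD 6 0).testBit 0) && (Nat.ble (((({1, 3, 4, 5, 6} : Finset (Fin 7))).filter fun q : Fin 7 => ((t.1).getD 0 0).testBit q.val = true).card) 1 && Nat.blt 1 (((({1, 3, 4, 5, 6} : Finset (Fin 7))).filter fun q : Fin 7 => ((t.1).getD 6 0).testBit q.val = true).card))) then t.2 else 0).sum : ℚ) : ℝ) :=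
  real_Dp_inter hnd hq (fun tb => Nat.ble (((({1, 3, 4, 5, 6} : Finset (Fin 7))).filter fun q : Fin 7 => ((tb).getD 0 0).testBit q.val = true).card) 1 && Nat.blt 1 (((({1, 3, 4, 5, 6} : Finset (Fin 7))).filter fun q : Fin 7 => ((tb).getD 6 0).testBit q.val = true).card))
    {ω : BondConfig (Fin 7) | (({1, 3, 4, 5, 6} : Finset (Fin 7)).filter fun q => ω ∈ openConn 0 q).card ≤ 1 ∧
      1 < (({1, 3, 4, 5, 6} : Finset (Fin 7)).filter fun q => ω ∈ openConn 6 q).card} fun ω => by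
    have hc0 : ((({1, 3, 4, 5, 6} : Finset (Fin 7))).filter fun q : Fin 7 => (((reachTable 7 ω)).getD 0 0).testBit q.val = true).card =
        ((({1, 3, 4, 5, 6} : Finset (Fin 7))).filter fun q => (↑(Eset ω) : Set (Sym2 (Fin 7))) ∈ openConn 0 q).card := cnt_reachTable ω 0
    have hc6 : ((({1, 3, 4, 5, 6} : Finset (Fin 7))).filter fun q : Fin 7 => (((reachTable 7 ω)).getD 6 0).testBit q.val = true).card =
        ((({1, 3, 4, 5, 6} : Finset (Fin 7))).filter fun q => (↑(Eset ω) : Set (Sym2 (Fin 7))) ∈ openConn 6 q).card := cnt_reachTable ω 6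
    rw [Bool.and_eq_true, Nat.ble_eq, Nat.blt_eq, hc0, hc6, Set.mem_setOf_eq]

/-- `μ(D' ∩ Sel₂ ∩ G₋)` as an exact weighted count. [this file] -/
theorem real_SelGm {l : List (Fin 7 × Fin 7 × ℚ)} (hnd : (wPairs l).Nodup) (hq : ∀ e ∈ l, 0 ≤ e.2.2 ∧ e.2.2 ≤ 1) :
    (prodBernoulli (wOfList l)).real
        ({ω : BondConfig (Fin 7) | ¬ (openGraph ω).Reachable 2 6 ∧ ¬ (openGraph ω).Reachable 2 0 ∧
          ¬ (openGraph ω).Reachable 6 0} ∩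
        {ω : BondConfig (Fin 7) | ((({1, 3, 4, 5, 6} : Finset (Fin 7)).filter fun q => ω ∈ openConn 6 q).card ≤ 1 ∧
          1 < (({1, 3, 4, 5, 6} : Finset (Fin 7)).filter fun q => ω ∈ openConn 0 q).card) ∧ (openGraph ω).Reachable 0 5}) =
      ((((wtabs 7 l).map fun t => if ((!((t.1).getD 2 0).testBit 6 && !((t.1).getD 2 0).testBit 0 && !((t.1).getD 6 0).testBit 0) && (Nat.ble (((({1, 3, 4, 5, 6} : Finset (Fin 7))).filter fun q : Fin 7 => ((t.1).getD 6 0).testBit q.val = true).card) 1 && Nat.blt 1 (((({1, 3, 4, 5, 6} : Finset (Fin 7))).filter fun q : Fin 7 => ((t.1).getD 0 0).testBit q.val = true).card) &&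
          (t.1.getD 0 0).testBit 5)) then t.2 else 0).sum : ℚ) : ℝ) :=
  real_Dp_inter hnd hq (fun tb => Nat.ble (((({1, 3, 4, 5, 6} : Finset (Fin 7))).filter fun q : Fin 7 => ((tb).getD 6 0).testBit q.val = true).card) 1 && Nat.blt 1 (((({1, 3, 4, 5, 6} : Finset (Fin 7))).filter fun q : Fin 7 => ((tb).getD 0 0).testBit q.val = true).card) && (tb.getD 0 0).testBit 5)
    {ω : BondConfig (Fin 7) | ((({1, 3, 4, 5, 6} : Finset (Fin 7)).filter fun q => ω ∈ openConn 6 q).card ≤ 1 ∧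
      1 < (({1, 3, 4, 5, 6} : Finset (Fin 7)).filter fun q => ω ∈ openConn 0 q).card) ∧ (openGraph ω).Reachable 0 5} fun ω => by
    have h05 : ((reachTable 7 ω).getD 0 0).testBit 5 = true ↔ (↑(Eset ω) : Set (Sym2 (Fin 7))) ∈ openConn (0 : Fin 7) (5 : Fin 7) :=
      testBit_reachTable_iff_mem_openConn ω (0 : Fin 7) (5 : Fin 7)
    have hc0 : ((({1, 3, 4, 5, 6} : Finset (Fin 7))).filter fun q : Fin 7 => (((reachTable 7 ω)).getD 0 0).testBit q.val = true).card =
        ((({1, 3, 4, 5, 6} : Finset (Fin 7))).filter fun q => (↑(Eset ω) : Set (Sym2 (Fin 7))) ∈ openConn 0 q).card := cnt_reachTable ω 0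
    have hc6 : ((({1, 3, 4, 5, 6} : Finset (Fin 7))).filter fun q : Fin 7 => (((reachTable 7 ω)).getD 6 0).testBit q.val = true).card =
        ((({1, 3, 4, 5, 6} : Finset (Fin 7))).filter fun q => (↑(Eset ω) : Set (Sym2 (Fin 7))) ∈ openConn 6 q).card := cnt_reachTable ω 6
    rw [Bool.and_eq_true, Bool.and_eq_true, Nat.ble_eq, Nat.blt_eq, hc0, hc6, Set.mem_setOf_eq]
    exact ⟨fun ⟨⟨h1, h2⟩, h3⟩ => ⟨⟨h1, h2⟩, h05.1 h3⟩, fun ⟨⟨h1, h2⟩, h3⟩ => ⟨⟨h1, h2⟩, h05.2 h3⟩⟩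

/-- **From one checkable rational fact to the violating instance** of (LE) on `Fin 7` (`x₂ = 0`, `x₁ = 6`, `z = 2`, `b = 5`,
relays `{1,3,4,5,6}`, `j = 1`). [this file] -/
theorem violation_of_check (l : List (Fin 7 × Fin 7 × ℚ)) (hnd : (wPairs l).Nodup)
    (hq : ∀ e ∈ l, 0 ≤ e.2.2 ∧ e.2.2 ≤ 1)
    (hlt : ((wtabs 7 l).map fun t => if ((!((t.1).getD 2 0).testBit 6 && !((t.1).getD 2 0).testBit 0 && !((t.1).getD 6 0).testBit 0) && (Nat.ble (((({1, 3, 4, 5, 6} : Finset (Fin 7))).filter fun q : Fin 7 => ((t.1).getD 0 0).testBit q.val = true).card) 1 && Nat.blt 1 (((({1, 3, 4, 5, 6} : Finset (Fin 7))).filter fun q : Fin 7 => ((t.1).getD 6 0).testBit q.val = true).card))) then t.2 else 0).sum *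
        ((wtabs 7 l).map fun t => if ((!((t.1).getD 2 0).testBit 6 && !((t.1).getD 2 0).testBit 0 && !((t.1).getD 6 0).testBit 0) && (Nat.ble (((({1, 3, 4, 5, 6} : Finset (Fin 7))).filter fun q : Fin 7 => ((t.1).getD 6 0).testBit q.val = true).card) 1 && Nat.blt 1 (((({1, 3, 4, 5, 6} : Finset (Fin 7))).filter fun q : Fin 7 => ((t.1).getD 0 0).testBit q.val = true).card) &&
          (t.1.getD 0 0).testBit 5)) then t.2 else 0).sum <
      ((wtabs 7 l).map fun t => if ((!((t.1).getD 2 0).testBit 6 && !((t.1).getD 2 0).testBit 0 && !((t.1).getD 6 0).testBit 0) && (Nat.ble (((({1, 3, 4, 5, 6} : Finset (Fin 7))).filter fun q : Fin 7 => ((t.1).getD 0 0).testBit q.val = true).card) 1 && Nat.blt 1 (((({1, 3, 4, 5, 6} : Finset (Fin 7))).filter fun q : Fin 7 => ((t.1).getD 6 0).testBit q.val = true).card) &&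
          (t.1.getD 0 0).testBit 5)) then t.2 else 0).sum *
        ((wtabs 7 l).map fun t => if ((!((t.1).getD 2 0).testBit 6 && !((t.1).getD 2 0).testBit 0 && !((t.1).getD 6 0).testBit 0) && (Nat.ble (((({1, 3, 4, 5, 6} : Finset (Fin 7))).filter fun q : Fin 7 => ((t.1).getD 6 0).testBit q.val = true).card) 1 && Nat.blt 1 (((({1, 3, 4, 5, 6} : Finset (Fin 7))).filter fun q : Fin 7 => ((t.1).getD 0 0).testBit q.val = true).card))) then t.2 else 0).sum) :
    (prodBernoulli (wOfList l)).real
        ({ω : BondConfig (Fin 7) | ¬ (openGraph ω).Reachable 2 6 ∧ ¬ (openGraph ω).Reachable 2 0 ∧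
          ¬ (openGraph ω).Reachable 6 0} ∩
        {ω : BondConfig (Fin 7) | (({1, 3, 4, 5, 6} : Finset (Fin 7)).filter fun q => ω ∈ openConn 0 q).card ≤ 1 ∧
          1 < (({1, 3, 4, 5, 6} : Finset (Fin 7)).filter fun q => ω ∈ openConn 6 q).card}) *
      (prodBernoulli (wOfList l)).real
        ({ω : BondConfig (Fin 7) | ¬ (openGraph ω).Reachable 2 6 ∧ ¬ (openGraph ω).Reachable 2 0 ∧
          ¬ (openGraph ω).Reachable 6 0} ∩
        {ω : BondConfig (Fin 7) | ((({1, 3, 4, 5, 6} : Finset (Fin 7)).filter fun q => ω ∈ openConn 6 q).card ≤ 1 ∧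
          1 < (({1, 3, 4, 5, 6} : Finset (Fin 7)).filter fun q => ω ∈ openConn 0 q).card) ∧ (openGraph ω).Reachable 0 5}) <
    (prodBernoulli (wOfList l)).real
        ({ω : BondConfig (Fin 7) | ¬ (openGraph ω).Reachable 2 6 ∧ ¬ (openGraph ω).Reachable 2 0 ∧
          ¬ (openGraph ω).Reachable 6 0} ∩
        {ω : BondConfig (Fin 7) | ((({1, 3, 4, 5, 6} : Finset (Fin 7)).filter fun q => ω ∈ openConn 0 q).card ≤ 1 ∧
          1 < (({1, 3, 4, 5, 6} : Finset (Fin 7)).filter fun q => ω ∈ openConn 6 q).card) ∧ (openGraph ω).Reachable 0 5}) *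
      (prodBernoulli (wOfList l)).real
        ({ω : BondConfig (Fin 7) | ¬ (openGraph ω).Reachable 2 6 ∧ ¬ (openGraph ω).Reachable 2 0 ∧
          ¬ (openGraph ω).Reachable 6 0} ∩
        {ω : BondConfig (Fin 7) | (({1, 3, 4, 5, 6} : Finset (Fin 7)).filter fun q => ω ∈ openConn 6 q).card ≤ 1 ∧
          1 < (({1, 3, 4, 5, 6} : Finset (Fin 7)).filter fun q => ω ∈ openConn 0 q).card}) := by
  rw [real_Gp hnd hq, real_SelGm hnd hq, real_GpSel hnd hq, real_Gm hnd hq]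
  exact_mod_cast hlt

end LocalizedExchangeCex

open LocalizedExchangeCex in
/-- **(LE) fails for a relay marker: the instance.**  Weights on `Fin 7`: `w(0,1) = 9/10`, `w(1,3) = 1`, `w(0,5) = 1/2`, `w(4,5) = 5/6`,
`w(4,6) = 1/2`, `w(2,4) = 1/2`, `w(2,5) = 9/10`, all other pairs `0`; relays `{1,3,4,5,6}`, `j = 1`, `x₂ = 0`, `x₁ = 6`, `z = 2`, marker `b = 5`
(a relay):  `μ(D'∩G₊) · μ(D'∩Sel₂∩G₋) < μ(D'∩G₊∩Sel₂) · μ(D'∩G₋)` (`(1/300)(17/1200) < (1/4800)(287/1200)`; exact rationals by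
`native_decide`). [this file] -/
theorem localizedExchange_cex : ∃ w : Sym2 (Fin 7) → unitInterval,
    (prodBernoulli w).real
        ({ω : BondConfig (Fin 7) | ¬ (openGraph ω).Reachable 2 6 ∧ ¬ (openGraph ω).Reachable 2 0 ∧
          ¬ (openGraph ω).Reachable 6 0} ∩
        {ω : BondConfig (Fin 7) | (({1, 3, 4, 5, 6} : Finset (Fin 7)).filter fun q => ω ∈ openConn 0 q).card ≤ 1 ∧
          1 < (({1, 3, 4, 5, 6} : Finset (Fin 7)).filter fun q => ω ∈ openConn 6 q).card}) *
      (prodBernoulli w).real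
        ({ω : BondConfig (Fin 7) | ¬ (openGraph ω).Reachable 2 6 ∧ ¬ (openGraph ω).Reachable 2 0 ∧
          ¬ (openGraph ω).Reachable 6 0} ∩
        {ω : BondConfig (Fin 7) | ((({1, 3, 4, 5, 6} : Finset (Fin 7)).filter fun q => ω ∈ openConn 6 q).card ≤ 1 ∧
          1 < (({1, 3, 4, 5, 6} : Finset (Fin 7)).filter fun q => ω ∈ openConn 0 q).card) ∧ (openGraph ω).Reachable 0 5}) <
    (prodBernoulli w).real
        ({ω : BondConfig (Fin 7) | ¬ (openGraph ω).Reachable 2 6 ∧ ¬ (openGraph ω).Reachable 2 0 ∧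
          ¬ (openGraph ω).Reachable 6 0} ∩
        {ω : BondConfig (Fin 7) | ((({1, 3, 4, 5, 6} : Finset (Fin 7)).filter fun q => ω ∈ openConn 0 q).card ≤ 1 ∧
          1 < (({1, 3, 4, 5, 6} : Finset (Fin 7)).filter fun q => ω ∈ openConn 6 q).card) ∧ (openGraph ω).Reachable 0 5}) *
      (prodBernoulli w).real
        ({ω : BondConfig (Fin 7) | ¬ (openGraph ω).Reachable 2 6 ∧ ¬ (openGraph ω).Reachable 2 0 ∧
          ¬ (openGraph ω).Reachable 6 0} ∩
        {ω : BondConfig (Fin 7) | (({1, 3, 4, 5, 6} : Finset (Fin 7)).filter fun q => ω ∈ openConn 6 q).card ≤ 1 ∧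
          1 < (({1, 3, 4, 5, 6} : Finset (Fin 7)).filter fun q => ω ∈ openConn 0 q).card}) :=
  ⟨_, violation_of_check
    [(0, 1, 9/10), (1, 3, 1), (0, 5, 1/2), (4, 5, 5/6), (4, 6, 1/2), (2, 4, 1/2), (2, 5, 9/10)]
    (by decide)
    (by
      intro e he
      simp only [List.mem_cons, List.not_mem_nil, or_false] at he
      rcases he with rfl | rfl | rfl | rfl | rfl | rfl | rfl <;> norm_num)
    (by native_decide)⟩

/-- **No-go: the localized exchange (LE) of the hull-port programme is false, even for a relay marker.**  It is false that for every finite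
weighted graph, relay set `A`, level `j`, observers `x₁, x₂`, guard `z` and RELAY marker `b ∈ A` (all distinct),
`μ(D'∩G₊∩Sel₂) · μ(D'∩G₋) ≤ μ(D'∩G₊) · μ(D'∩Sel₂∩G₋)` with `D' = {z↮x₁}∩{z↮x₂}∩{x₁↮x₂}`, `G₊ = {|π(x₂)| ≤ j < |π(x₁)|}`,
`G₋ = {|π(x₁)| ≤ j < |π(x₂)|}`, `Sel₂ = {x₂ ↔ b}`.  Witness `localizedExchange_cex`.  (The weaker inequality (SP) that suffices for LSL —
tree `HullPort.lsl_of_sp` — has no known violation.) [this file] -/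
theorem localizedExchange_false :
    ¬ (∀ (n : ℕ) (w : Sym2 (Fin n) → unitInterval) (A : Finset (Fin n)) (j : ℕ) (x₁ x₂ z b : Fin n),
      [x₁, x₂, z, b].Nodup → b ∈ A →
      (prodBernoulli w).real
          ({ω : BondConfig (Fin n) | ¬ (openGraph ω).Reachable z x₁ ∧ ¬ (openGraph ω).Reachable z x₂ ∧
            ¬ (openGraph ω).Reachable x₁ x₂} ∩
          {ω : BondConfig (Fin n) | ((A.filter fun q => ω ∈ openConn x₂ q).card ≤ j ∧
            j < (A.filter fun q => ω ∈ openConn x₁ q).card) ∧ (openGraph ω).Reachable x₂ b}) *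
        (prodBernoulli w).real
          ({ω : BondConfig (Fin n) | ¬ (openGraph ω).Reachable z x₁ ∧ ¬ (openGraph ω).Reachable z x₂ ∧
            ¬ (openGraph ω).Reachable x₁ x₂} ∩
          {ω : BondConfig (Fin n) | (A.filter fun q => ω ∈ openConn x₁ q).card ≤ j ∧
            j < (A.filter fun q => ω ∈ openConn x₂ q).card}) ≤
      (prodBernoulli w).real
          ({ω : BondConfig (Fin n) | ¬ (openGraph ω).Reachable z x₁ ∧ ¬ (openGraph ω).Reachable z x₂ ∧
            ¬ (openGraph ω).Reachable x₁ x₂} ∩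
          {ω : BondConfig (Fin n) | (A.filter fun q => ω ∈ openConn x₂ q).card ≤ j ∧
            j < (A.filter fun q => ω ∈ openConn x₁ q).card}) *
        (prodBernoulli w).real
          ({ω : BondConfig (Fin n) | ¬ (openGraph ω).Reachable z x₁ ∧ ¬ (openGraph ω).Reachable z x₂ ∧
            ¬ (openGraph ω).Reachable x₁ x₂} ∩
          {ω : BondConfig (Fin n) | ((A.filter fun q => ω ∈ openConn x₁ q).card ≤ j ∧
            j < (A.filter fun q => ω ∈ openConn x₂ q).card) ∧ (openGraph ω).Reachable x₂ b})) := by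
  intro h
  obtain ⟨w, hgt⟩ := localizedExchange_cex
  have hb : (5 : Fin 7) ∈ ({1, 3, 4, 5, 6} : Finset (Fin 7)) := by decide
  have hle := h 7 w ({1, 3, 4, 5, 6} : Finset (Fin 7)) 1 6 0 2 5 (by decide) hb
  exact absurd hle (not_le.2 hgt)

end Summit.CriticalPhenomena.PercolationContinuityZ3.Theorems
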